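import Summits.MatrixMultiplication.MatrixMultiplication.Theorems.SoloInformedCwTwoHalfInduction
import Summits.MatrixMultiplication.MatrixMultiplication.Theorems.SoloInformedCwTwoReindex

/-!
# HALF-ORIENT reduces to RIGID systems (solo-informed, gen 13; CLAIMS c161/c162)

A mixed system is RIGID when no pair can be demoted to two singletons leaving a mixed design.  Combining the
lifting count of the demotion lemma with pair reindexing (the number of working orientations is invariant under
permuting the pairs, `workingOrientations_reindex`), HALF-ORIENT for all mixed designs follows by induction on the
number of pairs from HALF-ORIENT for the rigid ones (`halfOrientConjecture_of_fullyRigidStep`).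

Standard axioms only.
-/

namespace Summit.MatrixMultiplication.MatrixMultiplication.Theorems

open Finset

/-- Reindexing the pairs does not decrease the number of working orientations. -/
lemma workingOrientations_le_reindex {p q : ℕ} (s d : Fin p → ℕ) (t : Fin q → ℕ) (σ : Equiv.Perm (Fin p)) :
    workingOrientations s d t ≤ workingOrientations (fun k => s (σ k)) (fun k => d (σ k)) t := by
  classical
  unfold workingOrientations
  refine Finset.card_le_card_of_injOn (fun o : Fin p → Bool => fun k => o (σ k)) ?_ ?_
  · intro o ho
    have hw := (Finset.mem_filter.1 ho).2
    exact Finset.mem_filter.2 ⟨Finset.mem_univ _, orientedHallSix_reindex s d t o σ hw⟩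
  · intro o₁ _ o₂ _ h
    funext j
    have := congrFun h (σ.symm j)
    simpa using this

/-- **The number of working orientations is invariant under reindexing the pairs.** -/
theorem workingOrientations_reindex {p q : ℕ} (s d : Fin p → ℕ) (t : Fin q → ℕ) (σ : Equiv.Perm (Fin p)) :
    workingOrientations (fun k => s (σ k)) (fun k => d (σ k)) t = workingOrientations s d t := by
  refine le_antisymm ?_ (workingOrientations_le_reindex s d t σ)
  have h := workingOrientations_le_reindex (fun k => s (σ k)) (fun k => d (σ k)) t σ.symm
  simpa using h

/-- A mixed system with `p + 1` pairs is **rigid** when no reindexing of its pairs has a last-pair demotion that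
is a mixed design (i.e. no pair can be demoted to two singletons leaving a mixed design). -/
def IsRigid {p q : ℕ} (s d : Fin (p + 1) → ℕ) (t : Fin q → ℕ) : Prop :=
  ∀ σ : Equiv.Perm (Fin (p + 1)),
    ¬ IsMixedDesign (fun i : Fin p => s (σ i.castSucc)) (fun i => d (σ i.castSucc))
      (demoteT (fun k => s (σ k)) (fun k => d (σ k)) t)

/-- The residual hypothesis: HALF-ORIENT for RIGID mixed designs. -/
def HalfOrientFullyRigidStep : Prop :=
  ∀ {p q : ℕ} (s d : Fin (p + 1) → ℕ) (t : Fin q → ℕ), IsMixedDesign s d t → IsRigid s d t →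
    2 ^ (p + 1) ≤ 2 * workingOrientations s d t

/-- **Reduction of HALF-ORIENT to rigid systems.** -/
theorem halfOrientConjecture_of_fullyRigidStep (hstep : HalfOrientFullyRigidStep) : HalfOrientConjecture := by
  intro p
  induction p with
  | zero =>
    intro q s d t hD
    have := workingOrientations_pos_zero s d t hD
    simpa using by omega
  | succ p ih =>
    intro q s d t hD
    by_cases hrig : IsRigid s d t
    · exact hstep s d t hD hrig
    · simp only [IsRigid, not_forall, not_not] at hrig
      obtain ⟨σ, hdem⟩ := hrig
      have h1 := ih _ _ _ hdem
      have h2 := two_mul_workingOrientations_demote_le (fun k => s (σ k)) (fun k => d (σ k)) t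
      have h3 := workingOrientations_reindex s d t σ
      calc 2 ^ (p + 1) = 2 * 2 ^ p := by ring
        _ ≤ 2 * (2 * workingOrientations (fun i : Fin p => s (σ i.castSucc)) (fun i => d (σ i.castSucc))
              (demoteT (fun k => s (σ k)) (fun k => d (σ k)) t)) := by omega
        _ ≤ 2 * workingOrientations (fun k => s (σ k)) (fun k => d (σ k)) t := by omega
        _ = 2 * workingOrientations s d t := by rw [h3]

end Summit.MatrixMultiplication.MatrixMultiplication.Theorems
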